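import Summits.AtomisticToContinuum.BoseEinsteinCondensation.Theorems.BECCutLineWeakDisorderAcrossCutDefs
import Summits.AtomisticToContinuum.BoseEinsteinCondensation.Theorems.BECCutLineWeakDisorderTaggedShiftCoarseFreeGas
import HarnessLib

/-!
# Route `BECCutLineWeakDisorder`, crux `TwoReplicaTransienceBound` (stmt-AtomisticToContinuum-9687),
# line `across-cut-thinning` (v2): the module `MeanProfileFlat` — reduction to the continuum
# participation of the mean insertion profile, and the FREE-GAS calibration row

Support file (`--supports stmt-AtomisticToContinuum-9687`; proves the registered CALIBRATION stub
`stub_meanProfileFlatFreeGas : Goal.stub_meanProfileFlatFreeGas`, NOT the registered module stub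
`stub_meanProfileFlat : Goal.stub_meanProfileFlat` of
`Theorems/BECCutLineWeakDisorderAcrossCutDefs.lean`, which for interacting `v` hinges on an
`n`-uniform wall-layer bound for the one-point insertion amplitude of the Dirichlet dilute gas and
stays open).

* `meanAmp_eq_blockMass_meanProfile` — Tonelli: the block profile `Q ↦ B_Q = ∫ A_Q(Y) Z_n(Y) dY`
  is the block mass `a_Q(b) = ∫_Q b` of the MEAN insertion profile
  `b(x) = ∫ Z_{n+1}(x::Y) Z_n(Y) dY` (measurable `v`);
* `meanProfileFlat_of_continuum` — for EVERY depth `K`, `8^K Σ_Q B_Q² ≤ L³ ∫ b²` (block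
  Cauchy–Schwarz `pow_mul_levelSq_le`) and `∫ b ≤ Σ_Q B_Q` (covering), so the across-block
  participation `R*_K = 8^K Σ_Q B_Q²/(Σ_Q B_Q)²` of the module is at most the continuum
  participation `L³∫b²/(∫b)²` of `b` at every depth: the module's `∀ κ` (any kinetic depth) is
  implied by ONE continuum bound on `b`, uniformly in the depth;
* free gas `v ≡ 0`: `Z_{n+1}(x::Y) = θ_T(x) Z_n(Y)` (`fkPartition_vecCons_free`, `θ_T = Z^{(1)}_T`
  the one-line Dirichlet survival profile), so `A_Q(Y) = a_Q(θ_T) Z_n(Y)` (`blockAmp_free`),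
  `B_Q = a_Q(θ_T) · ∫Z_n²` (`meanAmp_free`) and `R*_K = 8^K S_K(θ_T)/(Σ_Q a_Q(θ_T))² ≤
  L³∫θ_T²/(∫θ_T)² ≤ C₀` (`free_ratio_le`): ONE absolute constant for every `L > 0`, `n`, `T ≥ 0`
  and EVERY depth (`meanProfileFlat_free_uniform`), whence the `v := fun _ => 0` row of
  `MeanProfileFlat` with all its other quantifiers verbatim (`stub_meanProfileFlatFreeGas`; they are
  idle for the free gas; the sharp constant is conjecturally `(π²/8)³ ≈ 1.878`, not formalised).

References (for the objects, not for any claim): B. Simon, *Schrödinger semigroups*, Bull. AMS 7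
(1982) §A1 (the profiles `e^{-tH}1`); K. L. Chung, Z. Zhao, *From Brownian Motion to Schrödinger's
Equation* (1995) Thm 3.17.
-/

noncomputable section

open MeasureTheory Filter Set Finset
open scoped ENNReal NNReal Topology BigOperators

namespace Summit.AtomisticToContinuum.BoseEinsteinCondensation.Cruxes.TwoReplicaTransienceBound.AcrossCutThinning

open Literature.MathematicalPhysics.QuantumManyBody.BoseGas
open Summit.AtomisticToContinuum.BoseEinsteinCondensation.Theses.BECCutLineWeakDisorder
open Summit.AtomisticToContinuum.BoseEinsteinCondensation.Cruxes.TwoReplicaTransienceBound.TracerDecoupling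
  (fkPartition_ne_top)
open Summit.AtomisticToContinuum.BoseEinsteinCondensation.Cruxes.TwoReplicaTransienceBound.TaggedShiftLogHarnack
  (kineticDepth pow_mul_levelSq_le)
open Summit.AtomisticToContinuum.BoseEinsteinCondensation.Cruxes.LandscapeBound.SiblingTelescopingChaining
open Summit.AtomisticToContinuum.BoseEinsteinCondensation.Cruxes.TwoReplicaTransienceBound.FreeGas
  (fkPartition_vecCons_free free_ratio_le measurable_fkPartition_one)
open Summit.AtomisticToContinuum.BoseEinsteinCondensation.Theorems.CutLineWitness (volume_box_ne_top)

variable {n : ℕ}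

/-! ### The registered calibration stub (audit alias) -/

namespace Goal

/-- Registered calibration stub `stub_meanProfileFlatFreeGas`: the `v := fun _ => 0` row of the
module `MeanProfileFlat` (its body without the `∀ v, IsRepulsiveFiniteRange v →` prefix, every other
quantifier verbatim): for every kinetic constant `κ > 0`, below some `ρ₀`, some `C₁`, eventually in
`n`, for all `T ≥ 1`, the across-block participation of the free mean insertion profile at the
kinetic depth is `≤ C₁`. -/
abbrev stub_meanProfileFlatFreeGas : Prop :=
  ∀ κ : ℝ, 0 < κ → ∃ ρ₀ : ℝ, 0 < ρ₀ ∧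
    ∀ ρ : ℝ, 0 < ρ → ρ < ρ₀ → ∃ C₁ : ℝ, 0 < C₁ ∧ ∀ᶠ n : ℕ in atTop, ∀ T : ℝ, 1 ≤ T →
      (8 : ℝ≥0∞) ^ kineticDepth κ ρ (sideLength ρ (n + 1)) *
          ∑ i : Fin 3 → Fin (2 ^ kineticDepth κ ρ (sideLength ρ (n + 1))),
            meanAmp (fun _ => 0) (sideLength ρ (n + 1)) T
              (kineticDepth κ ρ (sideLength ρ (n + 1))) i n ^ 2 ≤
        ENNReal.ofReal C₁ *
          (∑ i : Fin 3 → Fin (2 ^ kineticDepth κ ρ (sideLength ρ (n + 1))),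
            meanAmp (fun _ => 0) (sideLength ρ (n + 1)) T
              (kineticDepth κ ρ (sideLength ρ (n + 1))) i n) ^ 2

end Goal

/-! ### The block profile is the block mass of the mean insertion profile (general `v`) -/

section General

variable {v : ℝ → ℝ≥0∞} {L T : ℝ}

-- adapted from Cruxes/TwoReplicaTransienceBound/Lines/across_cut_thinning.lean (`measurable_partSlice_uncurry`)
/-- Joint measurability of `(Y, x) ↦ Z_{n+1}(x::Y)` (measurable `v`). [folklore] -/
theorem measurable_partSlice_uncurry (hv : Measurable v) (L T : ℝ) :
    Measurable fun p : Config n × Space => partSlice v L T p.1 p.2 := by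
  unfold partSlice fkPartition
  exact (measurable_fkSemigroup hv L T measurable_const).comp (measurable_vecCons.comp measurable_swap)

-- adapted from Cruxes/TwoReplicaTransienceBound/Lines/across_cut_thinning.lean (`measurable_fkPartition'`)
/-- Measurability of the bath partition function `Y ↦ Z_n(Y)` (measurable `v`). [folklore] -/
theorem measurable_fkPartition_bath (hv : Measurable v) (L T : ℝ) :
    Measurable fun Y : Config n => fkPartition v L T Y := by
  unfold fkPartition
  exact measurable_fkSemigroup hv L T measurable_const

-- adapted from Cruxes/TwoReplicaTransienceBound/Lines/across_cut_thinning.lean (`partSlice_eq_zero`)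
/-- The insertion slice vanishes off the box in the tagged coordinate (`T ≥ 0`). [folklore] -/
theorem partSlice_eq_zero_of_notMem (hT : 0 ≤ T) (Y : Config n) {x : Space} (hx : x ∉ box L) :
    partSlice v L T Y x = 0 := by
  unfold partSlice fkPartition
  have hX : Matrix.vecCons x Y ∉ boxN (n + 1) L := fun hmem => hx (by simpa using hmem 0)
  exact fkSemigroup_of_notMem v hT _ hX

/-- **Tonelli: `B_Q = a_Q(b)`** — the block profile `B_Q = ∫ A_Q(Y) Z_n(Y) dY` is the block mass of
the MEAN insertion profile `b(x) = ∫ Z_{n+1}(x::Y) Z_n(Y) dY` (measurable `v`). [folklore] -/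
theorem meanAmp_eq_blockMass_meanProfile (hv : Measurable v) (L T : ℝ) (j : ℕ)
    (i : Fin 3 → Fin (2 ^ j)) (n : ℕ) :
    meanAmp v L T j i n =
      blockMass (fun x => ∫⁻ Y : Config n, partSlice v L T Y x * fkPartition v L T Y) L j i := by
  unfold meanAmp blockAmp blockMass
  have hF : Measurable fun p : Config n × Space => partSlice v L T p.1 p.2 * fkPartition v L T p.1 :=
    (measurable_partSlice_uncurry hv L T).mul ((measurable_fkPartition_bath hv L T).comp measurable_fst)
  calc ∫⁻ Y : Config n, (∫⁻ x in dyadicCube L j i, partSlice v L T Y x) * fkPartition v L T Y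
      = ∫⁻ Y : Config n, ∫⁻ x in dyadicCube L j i, partSlice v L T Y x * fkPartition v L T Y :=
        lintegral_congr fun Y =>
          (lintegral_mul_const _ ((measurable_partSlice_uncurry hv L T).comp
            (measurable_const.prodMk measurable_id))).symm
    _ = ∫⁻ x in dyadicCube L j i, ∫⁻ Y : Config n, partSlice v L T Y x * fkPartition v L T Y :=
        lintegral_lintegral_swap hF.aemeasurable

/-- **The module at every depth is implied by the continuum participation of the mean profile.**
For measurable `v`, `L > 0`, `T ≥ 0` and EVERY depth `K`: with `b(x) = ∫ Z_{n+1}(x::Y) Z_n(Y) dY`,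
`8^K Σ_Q B_Q² ≤ L³ ∫ b²` (block Cauchy–Schwarz over the disjoint blocks) and `(∫ b)² ≤ (Σ_Q B_Q)²`
(the blocks cover the box, off which `b` vanishes); hence any bound `L³ ∫ b² ≤ C (∫ b)²` gives
`8^K Σ_Q B_Q² ≤ C (Σ_Q B_Q)²` — the across-block participation `R*_K` is nondecreasing to the
continuum one, so the module's `∀ κ` costs nothing beyond the continuum statement. [folklore] -/
theorem meanProfileFlat_of_continuum (hv : Measurable v) (hL : 0 < L) (hT : 0 ≤ T) (n K : ℕ)
    (C : ℝ≥0∞)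
    (hb : ENNReal.ofReal (L ^ 3) *
        ∫⁻ x, (∫⁻ Y : Config n, partSlice v L T Y x * fkPartition v L T Y) ^ 2 ≤
      C * (∫⁻ x, ∫⁻ Y : Config n, partSlice v L T Y x * fkPartition v L T Y) ^ 2) :
    (8 : ℝ≥0∞) ^ K * ∑ i : Fin 3 → Fin (2 ^ K), meanAmp v L T K i n ^ 2 ≤
      C * (∑ i : Fin 3 → Fin (2 ^ K), meanAmp v L T K i n) ^ 2 := by
  set b : Space → ℝ≥0∞ := fun x => ∫⁻ Y : Config n, partSlice v L T Y x * fkPartition v L T Y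
    with hbdef
  have hbm : Measurable b :=
    ((measurable_partSlice_uncurry hv L T).mul
      ((measurable_fkPartition_bath hv L T).comp measurable_fst)).lintegral_prod_left'
  have hb0 : ∀ x, x ∉ box L → b x = 0 := fun x hx => by
    simp [hbdef, partSlice_eq_zero_of_notMem hT _ hx]
  have hB : ∀ i : Fin 3 → Fin (2 ^ K), meanAmp v L T K i n = blockMass b L K i := fun i =>
    meanAmp_eq_blockMass_meanProfile hv L T K i n
  simp_rw [hB]
  calc (8 : ℝ≥0∞) ^ K * ∑ i : Fin 3 → Fin (2 ^ K), blockMass b L K i ^ 2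
      = 8 ^ K * levelSq b L K := rfl
    _ ≤ ENNReal.ofReal (L ^ 3) * ∫⁻ x, b x ^ 2 := pow_mul_levelSq_le hbm hL.le K
    _ ≤ C * (∫⁻ x, b x) ^ 2 := hb
    _ ≤ C * (∑ i : Fin 3 → Fin (2 ^ K), blockMass b L K i) ^ 2 :=
        mul_le_mul' le_rfl (pow_le_pow_left' (lintegral_le_sum_blockMass hL hb0 K) 2)

end General

/-! ### The free gas: factorisation of the block profile -/

/-- Free gas: the insertion slice factorises, `Z_{n+1}(x::Y) = θ_T(x) · Z_n(Y)` with
`θ_T = Z^{(1)}_T` the one-line Dirichlet survival profile (`fkPartition_vecCons_free`). [folklore] -/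
theorem partSlice_free (L T : ℝ) (Y : Config n) (x : Space) :
    partSlice (fun _ => 0) L T Y x =
      fkPartition (N := 1) (fun _ => 0) L T (fun _ => x) * fkPartition (fun _ => 0) L T Y :=
  fkPartition_vecCons_free L T x Y

/-- Free gas: the block insertion amplitude is `A_Q(Y) = a_Q(θ_T) · Z_n(Y)`. [folklore] -/
theorem blockAmp_free (L T : ℝ) (j : ℕ) (i : Fin 3 → Fin (2 ^ j)) (Y : Config n) :
    blockAmp (fun _ => 0) L T j i Y =
      blockMass (fun x => fkPartition (N := 1) (fun _ => 0) L T (fun _ => x)) L j i *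
        fkPartition (fun _ => 0) L T Y := by
  unfold blockAmp blockMass
  have h : partSlice (n := n) (fun _ => 0) L T Y =
      fun x => fkPartition (N := 1) (fun _ => 0) L T (fun _ => x) * fkPartition (fun _ => 0) L T Y :=
    funext (partSlice_free L T Y)
  rw [h, lintegral_mul_const _ (measurable_fkPartition_one measurable_const L T)]

/-- Free gas: the block profile is `B_Q = a_Q(θ_T) · ∫ Z_n²` (`= a_Q(θ_T) · bathTwo`). [folklore] -/
theorem meanAmp_free (L T : ℝ) (j : ℕ) (i : Fin 3 → Fin (2 ^ j)) (n : ℕ) :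
    meanAmp (fun _ => 0) L T j i n =
      blockMass (fun x => fkPartition (N := 1) (fun _ => 0) L T (fun _ => x)) L j i *
        bathTwo (fun _ => 0) L T n := by
  unfold meanAmp bathTwo
  simp_rw [blockAmp_free L T j i, mul_assoc, ← sq]
  exact lintegral_const_mul _ ((measurable_fkPartition_bath measurable_const L T).pow_const 2)

/-! ### The free gas: one absolute constant for every box, particle number, time and depth -/

/-- **Free gas: the across-block participation of the mean insertion profile is bounded by ONE
absolute constant**, for `v ≡ 0`, every `L > 0`, every `n`, every `T ≥ 0` and EVERY depth `K`:
`8^K Σ_Q B_Q² ≤ C (Σ_Q B_Q)²`. By `meanProfileFlat_of_continuum` it suffices to bound the continuum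
participation of the free mean profile `b = θ_T · ∫Z_n²` (`partSlice_free`): both sides carry the
factor `(∫Z_n²)²` and `L³∫θ_T² ≤ C₀ (∫θ_T)²` is the one-line ratio bound `free_ratio_le`
(`C = C₀ + 1`; the case `∫θ_T = 0` is `0 ≤ 0`). [folklore] -/
theorem meanProfileFlat_free_uniform : ∃ C : ℝ, 0 < C ∧ ∀ L : ℝ, 0 < L → ∀ (n : ℕ) (T : ℝ), 0 ≤ T →
    ∀ K : ℕ,
      (8 : ℝ≥0∞) ^ K * ∑ i : Fin 3 → Fin (2 ^ K), meanAmp (fun _ => 0) L T K i n ^ 2 ≤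
        ENNReal.ofReal C * (∑ i : Fin 3 → Fin (2 ^ K), meanAmp (fun _ => 0) L T K i n) ^ 2 := by
  obtain ⟨C₀, hC₀t, hC₀⟩ := free_ratio_le
  refine ⟨C₀.toReal + 1, by positivity, fun L hL n T hT K => ?_⟩
  have hvm : Measurable (fun _ : ℝ => (0 : ℝ≥0∞)) := measurable_const
  -- the one-line profile and the bath two-replica mass
  set θ : Space → ℝ≥0∞ := fun x => fkPartition (N := 1) (fun _ => 0) L T (fun _ => x) with hθdef
  set N2 : ℝ≥0∞ := bathTwo (fun _ => 0) L T n with hN2def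
  have hθm : Measurable θ := measurable_fkPartition_one hvm L T
  have hθ1 : ∀ x, θ x ≤ 1 := fun x => fkPartition_le_one _ L T _
  have hθ0 : ∀ x, x ∉ box L → θ x = 0 := fun x hx => by
    have : (fun _ : Fin 1 => x) ∉ boxN 1 L := fun h => hx (h 0)
    simp [hθdef, fkPartition, fkSemigroup_of_notMem (fun _ => (0 : ℝ≥0∞)) hT _ this]
  have hθtop : ∫⁻ x, θ x ≠ ⊤ := by
    refine ne_top_of_le_ne_top (ENNReal.mul_ne_top ENNReal.one_ne_top (volume_box_ne_top L)) ?_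
    calc ∫⁻ x, θ x ≤ ∫⁻ x, (box L).indicator 1 x := lintegral_mono fun x => by
            by_cases hxb : x ∈ box L
            · rw [Set.indicator_of_mem hxb]; exact hθ1 x
            · rw [Set.indicator_of_notMem hxb, hθ0 x hxb]
      _ = 1 * volume (box L) := by rw [lintegral_indicator_one (measurableSet_box L), one_mul]
  -- the constant
  have hCle : C₀ ≤ ENNReal.ofReal (C₀.toReal + 1) := by
    calc C₀ = ENNReal.ofReal C₀.toReal := (ENNReal.ofReal_toReal hC₀t).symm
      _ ≤ ENNReal.ofReal (C₀.toReal + 1) := ENNReal.ofReal_le_ofReal (by linarith)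
  refine meanProfileFlat_of_continuum hvm hL hT n K (ENNReal.ofReal (C₀.toReal + 1)) ?_
  -- the free mean profile is `b = θ_T · ∫Z_n²`
  have hb : ∀ x, ∫⁻ Y : Config n, partSlice (fun _ => 0) L T Y x * fkPartition (fun _ => 0) L T Y =
      θ x * N2 := by
    intro x
    simp_rw [partSlice_free L T _ x, mul_assoc, ← sq]
    exact lintegral_const_mul _ ((measurable_fkPartition_bath hvm L T).pow_const 2)
  simp_rw [hb]
  have hl : ∫⁻ x, (θ x * N2) ^ 2 = (∫⁻ x, θ x ^ 2) * N2 ^ 2 := by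
    simp_rw [mul_pow]
    exact lintegral_mul_const _ (hθm.pow_const 2)
  have hr : (∫⁻ x, θ x * N2) ^ 2 = (∫⁻ x, θ x) ^ 2 * N2 ^ 2 := by
    rw [lintegral_mul_const _ hθm, mul_pow]
  rw [hl, hr, ← mul_assoc, ← mul_assoc]
  refine mul_le_mul' ?_ le_rfl
  -- `L³ ∫θ_T² ≤ C (∫θ_T)²`
  by_cases hs0 : ∫⁻ x, θ x = 0
  · have hae : θ =ᵐ[volume] 0 := (lintegral_eq_zero_iff hθm).1 hs0
    have hm0 : ∫⁻ x, θ x ^ 2 = 0 := by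
      refine (lintegral_eq_zero_iff (hθm.pow_const 2)).2 ?_
      filter_upwards [hae] with x hx
      simp [hx]
    rw [hm0, mul_zero]
    exact bot_le
  calc ENNReal.ofReal (L ^ 3) * ∫⁻ x, θ x ^ 2
      = ENNReal.ofReal (L ^ 3) * (∫⁻ x, θ x ^ 2) / (∫⁻ x, θ x) ^ 2 * (∫⁻ x, θ x) ^ 2 :=
        (ENNReal.div_mul_cancel (pow_ne_zero 2 hs0) (ENNReal.pow_ne_top hθtop)).symm
    _ ≤ C₀ * (∫⁻ x, θ x) ^ 2 := mul_le_mul' (hC₀ _ hvm L hL T hT) le_rfl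
    _ ≤ ENNReal.ofReal (C₀.toReal + 1) * (∫⁻ x, θ x) ^ 2 := mul_le_mul' hCle le_rfl

/-- **The free-gas row of `MeanProfileFlat`** (`v := fun _ => 0`, every other quantifier verbatim;
`ρ₀ = 1`, `∀ᶠ n` and `1 ≤ T` are idle, the constant is the absolute one of
`meanProfileFlat_free_uniform`). [folklore] -/
theorem meanProfileFlat_free : Goal.stub_meanProfileFlatFreeGas := by
  intro κ _hκ
  obtain ⟨C, hC, H⟩ := meanProfileFlat_free_uniform
  refine ⟨1, one_pos, fun ρ hρ _ => ⟨C, hC, Filter.Eventually.of_forall fun n T hT => ?_⟩⟩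
  have hL : 0 < sideLength ρ (n + 1) :=
    Real.rpow_pos_of_pos (div_pos (Nat.cast_pos.mpr n.succ_pos) hρ) _
  exact H _ hL n T (zero_le_one.trans hT) _

/-- PROVED calibration stub `stub_meanProfileFlatFreeGas` (= `meanProfileFlat_free`): the module
`MeanProfileFlat` holds for the free gas, with one absolute constant. -/
theorem stub_meanProfileFlatFreeGas : Goal.stub_meanProfileFlatFreeGas := meanProfileFlat_free

end Summit.AtomisticToContinuum.BoseEinsteinCondensation.Cruxes.TwoReplicaTransienceBound.AcrossCutThinning

end
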